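import Summits.RiemannHypothesis.RiemannHypothesis.Theorems.NymanBeurlingNbThesisZeroFloor
import Literature.NumberTheory.LFunctions.RiemannHypothesisUpTo101
import Literature.NumberTheory.DiophantineGeometry.NamedHypothesesRHProofs
import Mathlib.Analysis.Real.Pi.Bounds
import Literature.Barriers.RiemannHypothesis.BettinGonek2017Thm2Proofs
import HarnessLib

/-!
# Costume detectors IV (NB: Nyman–Beurling / Báez-Duarte) — cell `rh-split`

HONEST LABEL: «SPLITTING SEARCH over kernel-typed RH-EQUIVALENCES; a splitting A ∧ B ⟹ RH is CONDITIONAL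
bookkeeping unless A and B are both proved; nothing here bears on the truth of RH.»

Companion of `CostumeDetectors.lean` (index tails), `CostumeDetectorsHeight.lean` (height tails), `CostumeDetectorsLi.lean`.
NEGATIVE KNOWLEDGE for future planners (brief `RH-SPLITTING-BRIEF.md` sha16 f79c5f09d8bcb036; cards SPLIT-nb-finite,
SPLIT-nb-bridge, SPLIT-nb-neg).  `E_NB = Theses.NymanBeurling.NbThesis` (`∀ ε > 0, ∃ N a, I(N,a) < ε`; kernel
`Theorems.nbThesis_iff`) is a TAIL EVENT in `N`, so it has no load-bearing finite conjunct of its own; its only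
finite object is a WITNESS `I(N,a) < η`, whose complementary LENS TAIL is RH by itself at every feasible resolution
(§1, F1-free, via RH to the KERNEL height `101`); and the one in-print conjecture carrying an NB tail, Farmer's
`θ = ∞` in Bettin–Gonek's dyadic form restricted to heights `T ≥ H`, implies RH by itself for every `H ≥ 2` (§2, via the
tree's Bettin–Gonek Theorem 2), so the finite part `RiemannHypothesisUpTo H` is decoration there too.  Raw quantified
forms only (no `def`).  Typed by rh-split-nb-finite (§1) and rh-split-nb-bridge (§2), replayed and filed by
rh-split-typer-1, refereed by rh-split-ref.  Inside this namespace the bare token `RiemannHypothesis` is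
`Summit.RiemannHypothesis`; Mathlib's is `_root_.RiemannHypothesis`.
-/

noncomputable section

-- D-0017: `Summit.<S>.<S>.…` is the designed namespace of a single-problem summit.
set_option linter.dupNamespace false

open Complex MeasureTheory Set Filter
open scoped Real ENNReal

namespace Summit.RiemannHypothesis.RiemannHypothesis.Theorems.Splittings.CostumeDetectorsNb

open Literature.NumberTheory.LFunctions Literature.NumberTheory.DiophantineGeometry
open Literature.Barriers.RiemannHypothesis
open Summit.RiemannHypothesis.RiemannHypothesis.Theorems

/-! ## §1 NB witness / lens tail (typed by rh-split-nb-finite) — `E_NB = NbThesis` (`nbThesis_iff`); witness ∧ lens-tail; the lens tail is RH at the kernel height 101, F1-free -/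

/-- Splitting nb/finite (brief rh-split nb; card SPLIT-nb-finite): a Nyman–Beurling WITNESS `I(N,a) < η`
(RH-FREE, finite data) and the LENS TAIL at resolution `η` (every zero right of the line has Beurling floor
`≥ η`) give RH — tree `nb_zero_constraint_of_witness` + `quasiRiemannHypothesis_one_half_iff_holds`.
[cite: Beurling1955, Theorem (easy half)] -/
theorem rh_of_nbWitness_nbLensTail (N : ℕ) (η : ℝ) (a : Fin N → ℂ)
    (hA : ∫⁻ t : ℝ, ENNReal.ofReal (‖1 - riemannZeta (1 / 2 + t * Complex.I) *
        ∑ n : Fin N, a n * ((n : ℂ) + 1) ^ (-(1 / 2 + t * Complex.I))‖ ^ 2 / (1 / 4 + t ^ 2)) <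
      ENNReal.ofReal η)
    (hB : ∀ ρ : ℂ, riemannZeta ρ = 0 → 1 / 2 < ρ.re →
      η ≤ 4 * π * (ρ.re - 1 / 2) ^ 2 * ‖ρ - 1‖ ^ 2 / (‖ρ‖ ^ 4 * ‖ρ + 1‖ ^ 2)) :
    _root_.RiemannHypothesis :=
  quasiRiemannHypothesis_one_half_iff_holds.1 fun s hζ hσ _ ↦
    (not_lt.2 (hB s hζ hσ)) (nb_zero_constraint_of_witness hA hζ hσ)

/-- RH ⟹ the NB lens tail at every resolution (vacuous: no zero with `1/2 < Re ρ`), so once a witness is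
certified the lens tail is RH-EQUIVALENT by `tail_forced_label` (brief rh-split nb). [cite: DavenportMNT1980, ch. 8] -/
theorem nbLensTail_of_rh (h : _root_.RiemannHypothesis) (η : ℝ) :
    ∀ ρ : ℂ, riemannZeta ρ = 0 → 1 / 2 < ρ.re →
      η ≤ 4 * π * (ρ.re - 1 / 2) ^ 2 * ‖ρ - 1‖ ^ 2 / (‖ρ‖ ^ 4 * ‖ρ + 1‖ ^ 2) := by
  intro ρ hζ hρ
  exfalso
  rcases lt_or_ge ρ.re 1 with h1 | h1
  · exact quasiRiemannHypothesis_one_half_iff_holds.2 h ρ hζ hρ h1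
  · exact riemannZeta_ne_zero_of_one_le_re h1 hζ

/-- The Beurling floor of a point with `1/2 < Re ρ < 1`, `Im ρ ≠ 0` is `< π/(Im ρ)⁴` (`(Re ρ-1/2)² < 1/4`,
`‖ρ-1‖ ≤ ‖ρ+1‖`, `(Im ρ)⁴ ≤ ‖ρ‖⁴`): a witness of resolution `η` sees only heights `< (π/η)^{1/4}`
(brief rh-split nb). [cite: Beurling1955, Theorem (easy half)] -/
theorem nbLensWeight_lt_pi_div {ρ : ℂ} (hρ : 1 / 2 < ρ.re) (hρ1 : ρ.re < 1) (hγ : 0 < |ρ.im|) :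
    4 * π * (ρ.re - 1 / 2) ^ 2 * ‖ρ - 1‖ ^ 2 / (‖ρ‖ ^ 4 * ‖ρ + 1‖ ^ 2) < π / ρ.im ^ 4 := by
  have him0 : ρ.im ≠ 0 := abs_pos.mp hγ
  have him4 : 0 < ρ.im ^ 4 := by
    rw [show ρ.im ^ 4 = (ρ.im ^ 2) ^ 2 by ring]; positivity
  have hne1 : ρ ≠ 1 := by
    intro h; rw [h] at him0; simp at him0
  have hρ0 : 0 < ‖ρ‖ := by
    refine norm_pos_iff.mpr ?_
    intro h0; rw [h0] at hρ; simp at hρ; linarith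
  have hρm1 : 0 < ‖ρ + 1‖ := by
    refine norm_pos_iff.mpr ?_
    intro h0
    have : (ρ + 1).re = 0 := by rw [h0]; simp
    simp at this; linarith
  have hden : 0 < ‖ρ‖ ^ 4 * ‖ρ + 1‖ ^ 2 := by positivity
  have hA : 0 < ‖ρ - 1‖ ^ 2 * ρ.im ^ 4 :=
    mul_pos (pow_pos (norm_pos_iff.mpr (sub_ne_zero.mpr hne1)) 2) him4
  have h1 : 4 * (ρ.re - 1 / 2) ^ 2 < 1 := by
    nlinarith [mul_pos (show (0 : ℝ) < 1 - (ρ.re - 1 / 2) * 2 by linarith)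
      (show (0 : ℝ) < 1 + (ρ.re - 1 / 2) * 2 by linarith)]
  have h2 : ‖ρ - 1‖ ^ 2 ≤ ‖ρ + 1‖ ^ 2 := by
    rw [Complex.sq_norm, Complex.sq_norm, Complex.normSq_apply, Complex.normSq_apply]
    simp; nlinarith
  have h3 : ρ.im ^ 4 ≤ ‖ρ‖ ^ 4 := by
    have h : ρ.im ^ 2 ≤ ‖ρ‖ ^ 2 := by
      rw [Complex.sq_norm, Complex.normSq_apply]; nlinarith
    calc ρ.im ^ 4 = (ρ.im ^ 2) ^ 2 := by ring
      _ ≤ (‖ρ‖ ^ 2) ^ 2 := pow_le_pow_left₀ (sq_nonneg _) h 2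
      _ = ‖ρ‖ ^ 4 := by ring
  have hC : ‖ρ - 1‖ ^ 2 * ρ.im ^ 4 ≤ ‖ρ + 1‖ ^ 2 * ‖ρ‖ ^ 4 :=
    mul_le_mul h2 h3 him4.le (by positivity)
  rw [div_lt_div_iff₀ hden him4]
  calc 4 * π * (ρ.re - 1 / 2) ^ 2 * ‖ρ - 1‖ ^ 2 * ρ.im ^ 4
      = π * (4 * (ρ.re - 1 / 2) ^ 2 * (‖ρ - 1‖ ^ 2 * ρ.im ^ 4)) := by ring
    _ < π * (1 * (‖ρ - 1‖ ^ 2 * ρ.im ^ 4)) := by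
        exact mul_lt_mul_of_pos_left (mul_lt_mul_of_pos_right h1 hA) Real.pi_pos
    _ ≤ π * (‖ρ + 1‖ ^ 2 * ‖ρ‖ ^ 4) := by
        rw [one_mul]; exact mul_le_mul_of_nonneg_left hC Real.pi_pos.le
    _ = π * (‖ρ‖ ^ 4 * ‖ρ + 1‖ ^ 2) := by ring

/-- ZD-FIN DOMINATES NB-FIN (brief rh-split nb): RH up to height `H` already proves the zero-content of every
NB witness of resolution `η > π/H⁴` — no zero right of the line has floor `≥ η` (RH(H) for both signs of
`Im ρ`, `RiemannHypothesisUpTo.re_eq_of_im_neg`; no real zeros in the strip; `nbLensWeight_lt_pi_div`).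
[cite: Titchmarsh1986, §2.12 (text after (2.12.4))] -/
theorem nbLensWeight_lt_of_rhUpTo {H η : ℝ} (hH : 0 < H) (hRH : RiemannHypothesisUpTo H)
    (hη : π / H ^ 4 < η) {ρ : ℂ} (hζ : riemannZeta ρ = 0) (hρ : 1 / 2 < ρ.re) :
    4 * π * (ρ.re - 1 / 2) ^ 2 * ‖ρ - 1‖ ^ 2 / (‖ρ‖ ^ 4 * ‖ρ + 1‖ ^ 2) < η := by
  have hρ1 : ρ.re < 1 := by
    by_contra hge
    exact riemannZeta_ne_zero_of_one_le_re (not_lt.mp hge) hζ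
  have hpos : 0 < ρ.re := by linarith
  have hne : ρ.re ≠ 1 / 2 := ne_of_gt hρ
  have hγH : H < |ρ.im| := by
    by_contra hle
    push Not at hle
    rcases lt_trichotomy ρ.im 0 with him | him | him
    · exact hne (hRH.re_eq_of_im_neg hζ him (by rwa [abs_of_neg him] at hle))
    · exact riemannZeta_ne_zero_of_im_eq_zero_of_pos_of_lt_one him hpos hρ1 hζ
    · exact hne (hRH ρ hζ him (by rwa [abs_of_pos him] at hle))
  have hγ0 : 0 < |ρ.im| := hH.trans hγH
  have h4 : H ^ 4 ≤ ρ.im ^ 4 := by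
    rw [← (show Even 4 by norm_num).pow_abs ρ.im]
    exact pow_le_pow_left₀ hH.le hγH.le 4
  have hmono : π / ρ.im ^ 4 ≤ π / H ^ 4 :=
    div_le_div_of_nonneg_left Real.pi_pos.le (pow_pos hH 4) h4
  exact ((nbLensWeight_lt_pi_div hρ hρ1 hγ0).trans_le hmono).trans hη

/-- Costume detector, generic height (brief rh-split nb): RH(H) ∧ LENS-TAIL(η) ⟹ RH whenever `η > π/H⁴` —
the NB lens tail is `TailAbove((π/η)^{1/4})` in lens clothing. [cite: Titchmarsh1986, §2.12 (text after (2.12.4))] -/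
theorem rh_of_rhUpTo_nbLensTail {H η : ℝ} (hH : 0 < H) (hRH : RiemannHypothesisUpTo H)
    (hη : π / H ^ 4 < η)
    (hB : ∀ ρ : ℂ, riemannZeta ρ = 0 → 1 / 2 < ρ.re →
      η ≤ 4 * π * (ρ.re - 1 / 2) ^ 2 * ‖ρ - 1‖ ^ 2 / (‖ρ‖ ^ 4 * ‖ρ + 1‖ ^ 2)) :
    _root_.RiemannHypothesis :=
  quasiRiemannHypothesis_one_half_iff_holds.1 fun ρ hζ hρ _ ↦
    (not_le.2 (nbLensWeight_lt_of_rhUpTo hH hRH hη hζ hρ)) (hB ρ hζ hρ)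

/-- Costume detector / RH-EQUIVALENT tail, F1-free (brief rh-split nb): at the KERNEL height `H = 101`
(`riemannHypothesisUpTo_hundredOne`, standard axioms) the NB lens tail at any resolution `η ≥ 4·10⁻⁸ > π/101⁴`
implies RH by itself; every feasible witness has `η ≈ 0.29/log N ≫ 10⁻⁸`. [cite: Brent1979, §4] -/
theorem rh_of_nbLensTail_101 {η : ℝ} (hη : (4 : ℝ) / 10 ^ 8 ≤ η)
    (hB : ∀ ρ : ℂ, riemannZeta ρ = 0 → 1 / 2 < ρ.re →
      η ≤ 4 * π * (ρ.re - 1 / 2) ^ 2 * ‖ρ - 1‖ ^ 2 / (‖ρ‖ ^ 4 * ‖ρ + 1‖ ^ 2)) :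
    _root_.RiemannHypothesis := by
  refine rh_of_rhUpTo_nbLensTail (H := 101) (by norm_num) riemannHypothesisUpTo_hundredOne
    (lt_of_lt_of_le ?_ hη) hB
  have hπ := Real.pi_lt_four
  rw [div_lt_div_iff₀ (by norm_num) (by norm_num)]
  nlinarith

/-- The NB lens tail at resolution `η ≥ 4·10⁻⁸` as an `↔` with RH, F1-free (brief rh-split nb; the expected
RELABELLING of the nb/finite split: its TAIL conjunct is RH in lens clothing). [cite: Brent1979, §4] -/
theorem nbLensTail_101_iff_rh {η : ℝ} (hη : (4 : ℝ) / 10 ^ 8 ≤ η) :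
    (∀ ρ : ℂ, riemannZeta ρ = 0 → 1 / 2 < ρ.re →
      η ≤ 4 * π * (ρ.re - 1 / 2) ^ 2 * ‖ρ - 1‖ ^ 2 / (‖ρ‖ ^ 4 * ‖ρ + 1‖ ^ 2)) ↔
    _root_.RiemannHypothesis :=
  ⟨rh_of_nbLensTail_101 hη, fun h ↦ nbLensTail_of_rh h η⟩

/-! ## §2 NB bridge: Farmer's `θ = ∞` (dyadic form, heights `T ≥ H`) is RH by itself (typed by rh-split-nb-bridge) -/

/-- Window monotonicity of the mollified second moment `I_N(T₁,T₂) = ∫ |M_N ζ(½+it)|²`: for `0 ≤ T`, `2T ≤ T'`,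
`I_N(T,2T) ≤ I_N(0,T')` (non-negative continuous integrand). [cite: BettinGonek2017, Theorem 2] -/
theorem mollifiedSecondMoment_window_le (N : ℕ) {T T' : ℝ} (hT : 0 ≤ T) (hT' : 2 * T ≤ T') :
    mollifiedSecondMoment N T (2 * T) ≤ mollifiedSecondMoment N 0 T' := by
  unfold mollifiedSecondMoment
  refine intervalIntegral.integral_mono_interval hT (by linarith) hT'
    (Filter.Eventually.of_forall fun t ↦ by positivity) ?_
  exact ((((continuous_levinsonMollifier_criticalLine N).norm).pow 2).mul
    ((continuous_riemannZeta_line.norm).pow 2)).intervalIntegrable _ _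

/-- CONDITIONAL-bridge detector (brief rh-split NB, card SPLIT-nb-bridge): Farmer's `θ = ∞` conjecture in the weak
dyadic form Bettin–Gonek's Theorem 2 consumes, ASSUMED ONLY FOR HEIGHTS `T ≥ H` (any `H ≥ 2`) — «for every `θ, ε > 0`
there is `C` with `I_N(T,2T) ≤ C·T^{1+ε}` for all `T ≥ H`, `2 ≤ N ≤ T^θ`» — ALREADY implies RH, with no finite part:
below `H` only finitely many `N ≤ H^θ` occur and each window is bounded by the fixed number `I_N(0,2H)`, so the
constant can be enlarged to give the printed `T ≥ 2` form, and then the tree's Bettin–Gonek theorem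
`riemannHypothesis_of_mollifiedSecondMoment_dyadic_bound` applies.  `C ⟹ RH` kernel; `RH ⟹ C` open in print.
[cite: BettinGonek2017, Theorem 2] -/
theorem rh_of_thetaInfinityTail {H : ℝ} (hH : 2 ≤ H)
    (h : ∀ θ : ℝ, 0 < θ → ∀ ε : ℝ, 0 < ε → ∃ C : ℝ, ∀ T : ℝ, H ≤ T → ∀ N : ℕ, 2 ≤ N →
      (N : ℝ) ≤ T ^ θ → mollifiedSecondMoment N T (2 * T) ≤ C * T ^ (1 + ε)) : _root_.RiemannHypothesis := by
  refine riemannHypothesis_of_mollifiedSecondMoment_dyadic_bound fun θ hθ ε hε ↦ ?_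
  obtain ⟨C, hC⟩ := h θ hθ ε hε
  set S : ℝ := ∑ N ∈ Finset.range (⌊H ^ θ⌋₊ + 1), mollifiedSecondMoment N 0 (2 * H) with hS
  have hS0 : 0 ≤ S :=
    Finset.sum_nonneg fun N _ ↦ mollifiedSecondMoment_nonneg N (by linarith)
  refine ⟨max C 0 + S, fun T hT N hN hNT ↦ ?_⟩
  have hT0 : 0 ≤ T := by linarith
  have hTpow : 1 ≤ T ^ (1 + ε) := Real.one_le_rpow (by linarith) (by linarith)
  have hCle : C ≤ max C 0 + S := (le_max_left C 0).trans (le_add_of_nonneg_right hS0)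
  rcases le_or_gt H T with hHT | hTH
  · calc mollifiedSecondMoment N T (2 * T) ≤ C * T ^ (1 + ε) := hC T hHT N hN hNT
      _ ≤ (max C 0 + S) * T ^ (1 + ε) :=
          mul_le_mul_of_nonneg_right hCle (Real.rpow_nonneg hT0 _)
  · have hNmem : N ∈ Finset.range (⌊H ^ θ⌋₊ + 1) := by
      rw [Finset.mem_range, Nat.lt_add_one_iff]
      exact Nat.le_floor (hNT.trans (Real.rpow_le_rpow hT0 hTH.le hθ.le))
    calc mollifiedSecondMoment N T (2 * T) ≤ mollifiedSecondMoment N 0 (2 * H) :=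
          mollifiedSecondMoment_window_le N hT0 (by linarith)
      _ ≤ S := Finset.single_le_sum
          (fun N _ ↦ mollifiedSecondMoment_nonneg N (by linarith)) hNmem
      _ = S * 1 := (mul_one S).symm
      _ ≤ (max C 0 + S) * T ^ (1 + ε) :=
          mul_le_mul (le_add_of_nonneg_left (le_max_right C 0)) hTpow zero_le_one
            (add_nonneg (le_max_right C 0) hS0)

/-- NB costume form: with A = `RiemannHypothesisUpTo H` and B = the `θ = ∞` tail above `H`, `A → B → RH` holds with `A`
UNUSED (decoration) — the bridge is «C ⟹ RH» renamed. [cite: BettinGonek2017, Theorem 2] -/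
theorem rh_of_rhUpTo_thetaInfinityTail {H : ℝ} (hH : 2 ≤ H) (_hA : RiemannHypothesisUpTo H)
    (hB : ∀ θ : ℝ, 0 < θ → ∀ ε : ℝ, 0 < ε → ∃ C : ℝ, ∀ T : ℝ, H ≤ T → ∀ N : ℕ, 2 ≤ N →
      (N : ℝ) ≤ T ^ θ → mollifiedSecondMoment N T (2 * T) ≤ C * T ^ (1 + ε)) : _root_.RiemannHypothesis :=
  rh_of_thetaInfinityTail hH hB

end Summit.RiemannHypothesis.RiemannHypothesis.Theorems.Splittings.CostumeDetectorsNb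

end
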